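import Literature.Analysis.FluidPDE.CheskidovShvydkoyHolds
import Literature.Analysis.FluidPDE.KNSSTypeIIContinuation
import HarnessLib

/-!
# Smooth extension past `T` under the Cheskidov–Shvydkoy dyadic smallness condition

Stub `stub_extension_of_dyadicSmall` of the birth skeleton of the crux
`TautLoopKelvin.CirculationFloor` (item `stmt-NavierStokesRegularity-1538`): the endgame of the
contrapositive chain "small circulations on all small circles ⇒ smooth extension past `T`".

There is an absolute `c > 0` such that a classical solution `(u, p)` of the unforced
Navier–Stokes equations on `ℝ³ × [0, T)` which is Leray–Hopf on `[0, T)` from `u 0`, with slice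
distributions `U t` (`t ∈ [0, T]`) satisfying
`limsup_{j → ∞} sup_{t ∈ (0, T)} 2^{-j} ‖Δ̇_j U(t)‖_∞ < c ν`, extends as a classical solution
past `T` (`HasSmoothExtensionPast ν 0 u T`).

Proof — a glue of PROVED tree facts, no new named fact:

* `c` is the constant of Cheskidov–Shvydkoy 2010, Lemma 3.2, in its discharged printed form
  `cheskidov_shvydkoy_dyadic_regular_holds` (`CheskidovShvydkoyHolds.lean`), whose hypotheses are
  letter for letter ours with `u₀ = u 0`; it gives `IsH1RegularOn (Ioc 0 T) u`
  (`‖u(t)‖_{H¹}` finite and continuous on `(0, T]`, INCLUDING `t = T`).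
* Continuation THROUGH `t = T` is the argument of
  `hasSmoothExtensionPast_of_bounded_of_local_H1_theory` (`KNSSTypeIIContinuation.lean`,
  Robinson–Rodrigo–Sadowski 2016, proof of Thm. 12.3, p. 170) after its line `hregT`, copied
  verbatim in `extension_of_isH1RegularOn_Ioc`: a uniform bound `‖u(t)‖²_{H¹} ≤ A` on
  `[T/2, T]` (`IsH1RegularOn.exists_forall_le`), Leray's local strong solutions with lifespan
  `τ = c ν³/(A² + 1)` (`leray_local_strong_H1_of_regular leray_local_regular_H1_holds`), restart
  at a good time `s ∈ (max (T/2) (T - τ/2), T)`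
  (`IsLerayHopfOn.exists_isLerayHopfOn_restart_Ioo`), classical representative of the strong
  solution in the Serrin class `L^∞_t L⁶_x` (`ladyzhenskaya_prodi_serrin_holds`,
  `memLqLp_top_six_of_isH1RegularOn_Icc`, `serrin_exponents_top_six`), weak–strong uniqueness
  (`serrin_weak_strong_uniqueness_holds`) upgraded to everywhere equality of the continuous
  slices, and gluing of the two classical solutions along `(s, T)`
  (`IsClassicalNSSolutionOn.glue`, through `comp_add_right` and `mono`).

The rapid decay of the datum is not used.

## References

* A. Cheskidov, R. Shvydkoy, Arch. Ration. Mech. Anal. 195 (2010) 159–169 = arXiv:0708.3067,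
  Lemma 3.2 (p. 5). [CheskidovShvydkoy2010]
* J. C. Robinson, J. L. Rodrigo, W. Sadowski, *The Three-Dimensional Navier–Stokes Equations.
  Classical theory*, CUP 2016: Thm. 6.10, Thm. 6.15, Thm. 8.17, proof of Thm. 12.3 (p. 170).
  [RobinsonRodrigoSadowski2016]
-/

noncomputable section

open MeasureTheory Set Function Filter Topology TopologicalSpace
open scoped NNReal ENNReal

-- the problem directory repeats the summit name; core's `dupNamespace` linter fires on every decl
set_option linter.dupNamespace false

namespace Summit.NavierStokesRegularity.NavierStokesRegularity.Theorems.CirculationFloor.Birth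

open Literature.Analysis.FluidPDE

/-- **Continuation through `t = T` of an `H¹`-regular classical Leray–Hopf solution**
(Robinson–Rodrigo–Sadowski 2016, proof of Thm. 12.3, p. 170, with Thm. 6.15 =
`leray_local_strong_H1_of_regular leray_local_regular_H1_holds`, Thm. 8.17 (first clause) =
`ladyzhenskaya_prodi_serrin_holds` and Thm. 6.10 = `serrin_weak_strong_uniqueness_holds`; the
argument of `hasSmoothExtensionPast_of_bounded_of_local_H1_theory` after its line `hregT`,
verbatim): a classical solution `(u, p)` of the unforced system on `ℝ³ × [0, T)`, Leray–Hopf on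
`[0, T)` from `u 0` and `H¹`-regular on `(0, T]`, extends as a classical solution past `T`.
[cite: RobinsonRodrigoSadowski2016, proof of Thm 12.3 (PDF p. 170) with Thms 6.15, 8.17, 6.10] -/
theorem extension_of_isH1RegularOn_Ioc {ν T : ℝ}
    {u : ℝ → EuclideanSpace ℝ (Fin 3) → EuclideanSpace ℝ (Fin 3)}
    {p : ℝ → EuclideanSpace ℝ (Fin 3) → ℝ} (hν : 0 < ν) (hT : 0 < T)
    (hcl : IsClassicalNSSolutionOn (Ico 0 T) ν 0 u p) (hLH : IsLerayHopfOn T ν 0 (u 0) u)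
    (hregT : IsH1RegularOn (Ioc 0 T) u) : HasSmoothExtensionPast ν 0 u T := by
  have h₁ : leray_local_strong_H1 := leray_local_strong_H1_of_regular leray_local_regular_H1_holds
  have hLPS : ladyzhenskaya_prodi_serrin := ladyzhenskaya_prodi_serrin_holds
  -- `‖u(t)‖²_{H¹} ≤ A < ∞` on `[T/2, T]`
  have hreg : IsH1RegularOn (Icc (T / 2) T) u :=
    hregT.mono fun t ht => ⟨by linarith [ht.1], ht.2⟩
  obtain ⟨A, hAtop, hA⟩ := hreg.exists_forall_le isCompact_Icc subset_rfl
  -- Leray's lifespan for data of squared `H¹` norm `≤ a = A.toReal`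
  obtain ⟨c, hc, hlocc⟩ := h₁
  set a : ℝ := A.toReal with ha
  have ha0 : 0 ≤ a := ENNReal.toReal_nonneg
  set τ : ℝ := c * ν ^ 3 / (a ^ 2 + 1) with hτ
  have hcν : 0 < c * ν ^ 3 := mul_pos hc (pow_pos hν 3)
  have hτpos : 0 < τ := div_pos hcν (by positivity)
  have hτc : a ^ 2 * τ ≤ c * ν ^ 3 := by
    have h1 : a ^ 2 * τ = c * ν ^ 3 * (a ^ 2 / (a ^ 2 + 1)) := by
      rw [hτ]
      ring
    rw [h1]
    exact mul_le_of_le_one_right hcν.le (div_le_one_of_le₀ (by linarith) (by positivity))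
  -- a good restart time `s ∈ (max (T/2) (T - τ/2), T)`
  set s₀ : ℝ := max (T / 2) (T - τ / 2) with hs₀
  have hs₀0 : 0 ≤ s₀ := le_max_of_le_left (by linarith)
  have hs₀T : s₀ < T := max_lt (by linarith) (by linarith)
  obtain ⟨s, hs, hLHs⟩ := hLH.exists_isLerayHopfOn_restart_Ioo hν.le hs₀0 hs₀T le_rfl
  have hsT2 : T / 2 ≤ s := (le_max_left _ _).trans hs.1.le
  have hsτ : T < s + τ := by
    have h1 : T - τ / 2 < s := (le_max_right _ _).trans_lt hs.1
    linarith
  have hs0 : 0 < s := by linarith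
  have hTs : 0 < T - s := sub_pos.2 hs.2
  have hTsτ : T - s ≤ τ := by linarith
  -- the datum `u s ∈ H¹` with `‖∇u(s)‖² ≤ a`
  have hu2 : MemLp (u s) 2 volume := hLH.memLp s ⟨hs0.le, hs.2.le⟩
  have hdiv : IsWeaklyDivFree (u s) := hLHs.isWeaklyDivFree_datum hTs
  have hgrad : eWeakGradL2Sq (u s) ≤ ENNReal.ofReal a := by
    calc eWeakGradL2Sq (u s) ≤ eH1NormSq (u s) := le_add_self
      _ ≤ A := hA s ⟨hsT2, hs.2.le⟩
      _ = ENNReal.ofReal a := (ENNReal.ofReal_toReal hAtop.ne).symm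
  -- Leray's local strong solution `v` from `u s` on `[0, τ]` (RRS Thm. 6.15)
  obtain ⟨v, hv, hv0, hvreg⟩ := hlocc hν hτpos hu2 hdiv ha0 hgrad hτc
  -- its classical representative `(V, P)` on `(0, τ]` (RRS Thm. 8.17, first clause, `L^∞_t L⁶_x`)
  have hvS : MemLqLp ∞ 6 v (Ioo 0 τ) :=
    memLqLp_top_six_of_isH1RegularOn_Icc hvreg fun t ht => hv.memLp t ht
  have hr6 : (3 : ℝ≥0∞) < 6 := by norm_num
  obtain ⟨V, P, hVP, hvV⟩ := hLPS hν hτpos hv hr6 serrin_exponents_top_six hvS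
  -- weak–strong uniqueness on `[0, T - s)`: `u (t + s) = v t` a.e., `0 < t ≤ T - s`
  have hae : ∀ t ∈ Ioc 0 (T - s), (fun t => u (t + s)) t =ᵐ[volume] v t :=
    serrin_weak_strong_uniqueness_holds hν hTs (hv.of_le hTsτ) hu2 (q := ∞) (r := 6) hr6
      serrin_exponents_top_six (hvS.mono_set (Ioo_subset_Ioo_right hTsτ)) hLHs
  -- everywhere agreement of the continuous slices on `(s, T)`
  have heq : ∀ t ∈ Ioo s T, u t = V (t + -s) := by
    intro t ht
    have hts : t - s ∈ Ioc 0 (T - s) := ⟨sub_pos.2 ht.1, by linarith [ht.2]⟩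
    have h1 : u t =ᵐ[volume] v (t - s) := by
      have h := hae (t - s) hts
      simpa only [sub_add_cancel] using h
    have h2 : v (t - s) =ᵐ[volume] V (t - s) := hvV (t - s) ⟨hts.1, hts.2.trans hTsτ⟩
    have hcu : Continuous (u t) :=
      (hcl.contDiff_velocity ⟨hs0.le.trans ht.1.le, ht.2⟩).continuous
    have hcV : Continuous (V (t - s)) :=
      (hVP.contDiff_velocity ⟨hts.1, hts.2.trans hTsτ⟩).continuous
    rw [← sub_eq_add_neg]
    exact (Continuous.ae_eq_iff_eq volume hcu hcV).1 (h1.trans h2)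
  -- the continuation piece `(V, P)(· - s)` on `(s, s + τ)`
  have h₂ : IsClassicalNSSolutionOn (Ioo s (s + τ)) ν 0 (fun t => V (t + -s))
      (fun t => P (t + -s)) := by
    have hVP' := hVP.comp_add_right (-s)
    have h0 : (fun t => (0 : ℝ → EuclideanSpace ℝ (Fin 3) → EuclideanSpace ℝ (Fin 3)) (t + -s)) =
        0 := rfl
    rw [h0] at hVP'
    exact hVP'.mono (fun t ht => ⟨by simp only [mem_Ioo] at ht ⊢; linarith [ht.1],
      by simp only [mem_Ioo] at ht ⊢; linarith [ht.2]⟩) isOpen_Ioo.uniqueDiffOn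
  -- glue along the overlap `(s, T)`
  exact ⟨s + τ, hsτ, _, _, hcl.glue h₂ hs0.le hs.2 hsτ.le heq, fun t ht => by
    simp only [if_pos ht.2]⟩

/-- **Stub `stub_extension_of_dyadicSmall` (Cheskidov–Shvydkoy 2010 Lemma 3.2 + continuation
through `t = T`).** There is an absolute `c > 0` such that a classical solution `(u, p)` of the
unforced Navier–Stokes equations on `ℝ³ × [0, T)` which is Leray–Hopf on `[0, T)` from a rapidly
decaying datum `u 0`, with slice distributions `U t` (`t ∈ [0, T]`) satisfying
`limsup_{j → ∞} sup_{t ∈ (0, T)} 2^{-j} ‖Δ̇_j U(t)‖_∞ < c ν`, extends as a classical solution past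
`T`. The constant is that of `cheskidov_shvydkoy_dyadic_regular_holds` (conclusion
`IsH1RegularOn (Ioc 0 T) u`), followed by `extension_of_isH1RegularOn_Ioc`; the rapid decay is
not used. [cite: CheskidovShvydkoy2010, Lemma 3.2] -/
theorem stub_extension_of_dyadicSmall :
    ∃ c : ℝ, 0 < c ∧ ∀ (ν T : ℝ), 0 < ν → 0 < T →
      ∀ (u : ℝ → EuclideanSpace ℝ (Fin 3) → EuclideanSpace ℝ (Fin 3)) (p : ℝ → EuclideanSpace ℝ (Fin 3) → ℝ),
        Literature.Analysis.FluidPDE.IsClassicalNSSolutionOn (Set.Ico 0 T) ν 0 u p →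
        Literature.Analysis.FluidPDE.IsLerayHopfOn T ν 0 (u 0) u →
        Literature.Analysis.FluidPDE.HasRapidSpatialDecay (u 0) →
        ∀ U : ℝ → TemperedDistribution (EuclideanSpace ℝ (Fin 3)) (EuclideanSpace ℂ (Fin 3)),
          (∀ t ∈ Set.Icc 0 T, Literature.Analysis.FluidPDE.IsDistributionOf (u t) (U t)) →
          Filter.limsup (fun j : ℕ => ⨆ t ∈ Set.Ioo 0 T,
              Literature.Analysis.FunctionSpaces.lpBlockWeight (-1) ⊤ (U t) (j : ℤ)) Filter.atTop <
            ENNReal.ofReal (c * ν) →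
          Literature.Analysis.FluidPDE.HasSmoothExtensionPast ν 0 u T := by
  obtain ⟨c, hc, hCS⟩ := cheskidov_shvydkoy_dyadic_regular_holds
  refine ⟨c, hc, ?_⟩
  intro ν T hν hT u p hcl hLH _ U hU hlim
  exact extension_of_isH1RegularOn_Ioc hν hT hcl hLH (hCS ν T hν hT (u 0) u U hLH hU hlim)

end Summit.NavierStokesRegularity.NavierStokesRegularity.Theorems.CirculationFloor.Birth

end
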